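import Summits.QuantumAdvantage.AdviceFreeQNC0.AffBells23JuntaDecorrelation
import Summits.QuantumAdvantage.AdviceFreeQNC0.AffBells23Transversal
import HarnessLib

/-!
# Sketch23 §4b corollary `VDOfJPD`, proved (ask P-23e)

`theorem vdOfJPD : VDOfJPD` and its unconditional form `vdOfJPD_holds`: a `δ`-regular frame `V` and a junta product with
`Σ_k |S_k|(|S_k| − 1) ≤ Λ₂` have every non-trivial frame-character correlation `≤ 2^Z (√3/2)^{(δZ)²/(δZ + Λ₂)}`.
Proof: the Turán/Caro–Wei transversal of the reading sets inside `supp(tV)` (`AffBells23.exists_transversal_ge`) has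
`|A| ≥ (δZ)²/(δZ + Λ₂)`; LEMMA JPD (`juntaProductDecorrelation`, `AffBells23JuntaDecorrelation`) gives `(√3/2)^{|A|}`; read the
exponent as a real power of `√3/2 ≤ 1`.  Separation NOT moved.
-/

noncomputable section

open Classical

namespace Summit.QuantumAdvantage.AdviceFreeQNC0

open Finset
open Literature.Computability.QuantumComplexity Literature.Computability.QuantumComplexity.RingHLF
open Literature.Computability.MetaComplexity Literature.Computability.MetaComplexity.Smolensky
open F4 TubePlanProof AffBells22

namespace AffBells23

/-- `√3/2 ∈ (0, 1]`. -/
theorem sqrt_three_div_two_pos : 0 < Real.sqrt 3 / 2 := by positivity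

/-- `√3/2 ≤ 1`. -/
theorem sqrt_three_div_two_le_one : Real.sqrt 3 / 2 ≤ 1 := by
  have : Real.sqrt 3 ≤ 2 := by
    rw [show (2 : ℝ) = Real.sqrt (2 ^ 2) by rw [Real.sqrt_sq (by norm_num)]]
    exact Real.sqrt_le_sqrt (by norm_num)
  linarith

/-- **`VDOfJPD` PROVED** (ROUND-22 §2.5 corollary): inside `supp(tV)` (weight `≥ δZ`) the Turán/Caro–Wei transversal of the reading sets
(`AffBells23.exists_transversal_ge`: `|A| ≥ (δZ)²/(δZ + Λ₂)`) feeds LEMMA JPD; the exponent is read as a real power of `√3/2 ≤ 1`. -/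
theorem vdOfJPD : VDOfJPD := by
  intro hJPD Z K m S σ V δ Λ₂ hδ hread hΛ _ hreg t ht
  set γ : Fin Z → ZMod 3 := fun p => ∑ l, t l * V l p with hγ
  set P : Finset (Fin Z) := univ.filter fun p : Fin Z => γ p ≠ 0 with hP
  have hwP : δ * Z ≤ (P.card : ℝ) := hreg t ht
  have hΛ' : (∑ k ∈ (univ : Finset (Fin K)), ((S k).card : ℝ) * (((S k).card : ℝ) - 1)) ≤ Λ₂ := hΛ
  obtain ⟨A, hAP, htr, hsize⟩ :=
    exists_transversal_ge (univ : Finset (Fin K)) S P (w := δ * Z) (by positivity) hwP hΛ'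
  have hJ := hJPD Z K S σ γ A hread (fun k => htr k (mem_univ k)) (fun p hp => (mem_filter.mp (hAP hp)).2)
  refine hJ.trans ?_
  refine mul_le_mul_of_nonneg_left ?_ (by positivity)
  rw [← Real.rpow_natCast]
  exact Real.rpow_le_rpow_of_exponent_ge sqrt_three_div_two_pos sqrt_three_div_two_le_one hsize

/-- The unconditional form: LEMMA JPD is a theorem (`juntaProductDecorrelation`). -/
theorem vdOfJPD_holds :
    ∀ (Z K m : ℕ) (S : Fin K → Finset (Fin Z)) (σ : Fin K → (Fin Z → Bool) → Bool) (V : Fin m → Fin Z → ZMod 3) (δ Λ₂ : ℝ),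
    0 < δ → (∀ k, ReadsOnly (S k) (σ k)) → ((∑ k, ((S k).card : ℝ) * ((S k).card - 1)) ≤ Λ₂) → 0 ≤ Λ₂ →
    (∀ t : Fin m → ZMod 3, t ≠ 0 → δ * Z ≤ ((univ.filter fun p : Fin Z => (∑ l, t l * V l p) ≠ 0).card : ℝ)) →
      ∀ t : Fin m → ZMod 3, t ≠ 0 →
        ‖∑ F : Fin Z → Bool, Complex.exp (2 * Real.pi * Complex.I / 3) ^ (∑ p, if F p then (∑ l, t l * V l p).val else 0) *
            ∏ k, (if σ k F then (-1 : ℂ) else 1)‖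
          ≤ (2 : ℝ) ^ Z * (Real.sqrt 3 / 2) ^ ((δ * Z) ^ 2 / (δ * Z + Λ₂)) :=
  vdOfJPD juntaProductDecorrelation

end AffBells23

end Summit.QuantumAdvantage.AdviceFreeQNC0
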